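import Mathlib
import Summits.AtomisticToContinuum.Crystallization.Theses.ChessboardParticlePlanes
import Summits.AtomisticToContinuum.Crystallization.Theorems.ChessboardParticlePlanesLjLaminarWindowsNSF
import HarnessLib

/-!
# The exact laminarity residual of line `Sketch` and the unconditional `η ≥ 3/8` case of the crux
`LjLaminarWindows` (stmt-AtomisticToContinuum-6711), lead c10

The landed glue `stub_glueNSF` (lead c8) consumes a.e. laminarity (board item stmt-14293) only at
thickness `t = η`, radius `R = L` and only *frequently* in `N`.  This file records the consequences:

* `glueNSF_at` — the glue with the laminarity hypothesis localised to ONE thickness `η`: along the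
  ground-state sequence, for all large radii `L` and every `δ > 0`, frequently in `N` fewer than `δ N`
  particles have a non-`(η, L)`-laminar window ("lim inf of the non-laminar density is `0`").  This is
  the exact residual of the line: everything else (NSF `nsf_holds`, window removal, shell bound, path
  count, `7/10` minimal distance, `23/20` connectivity) is a theorem.
* `LjLaminarWindows_of_laminarityAt` — the crux from that residual for every `η > 0`
  (registered stub `stub_laminarityAt` of skeleton rev. 16); `laminarityAt_of_laminarity` — the residual
  from the statement of stmt-14293, so the crux stays `blocked-on` 14293 exactly as before.
* `laminar_of_three_eighths_le` — for `t ≥ 3/8` every window is `t`-laminar (levels `(3/4)ℤ`, any unit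
  normal: every real is within `3/8` of `(3/4)ℤ`), whence `laminarityAt_of_three_eighths_le` and the
  UNCONDITIONAL theorem `ljLaminarWindows_of_three_eighths_le`: the body of `LjLaminarWindows` holds for
  every `η ≥ 3/8` and every `ε > 0` — Lennard-Jones ground states contain, at every large scale and
  frequently in `N`, `7/10`-separated particle-centred windows with internal energy `≤ 2(e* + ε)` per
  particle.  The open content of the crux is therefore exactly the layering at thicknesses `η < 3/8`.
-/

noncomputable section

open scoped BigOperators
open Filter Topology
open Literature.MathematicalPhysics.StatisticalMechanics
open Summit.AtomisticToContinuum.Crystallization.Theorems.ChargedEnergyGapNegative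

namespace Summit.AtomisticToContinuum.Crystallization.Theorems.LjLaminarWindowsSketch

/-- **Glue of the NSF branch at a single thickness `η`.** If along a Lennard-Jones ground-state sequence,
for all radii `L ≥ L₁` and every `δ > 0`, frequently in `N` fewer than `δ N` particles have a
non-`(η, L)`-laminar window, then (with NSF, window removal, the shell bound and the path count, all
theorems) for every `ε > 0` there is `L₀` such that for every `L ≥ L₀`, frequently in `N`, some
particle-centred closed `L`-ball is `7/10`-separated, `η`-laminar and has internal energy `≤ 2(e* + ε)`
per particle.  Proof = `stub_glueNSF` with `Frequently.and_eventually` in place of the eventual bound.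
[folklore] -/
theorem glueNSF_at (η : ℝ)
    (hLamAt : ∀ x : (N : ℕ) → (Fin N → EuclideanSpace ℝ (Fin 3)),
      (∀ N, IsGroundState lennardJones (x N)) → ∃ L₁ : ℝ, ∀ L : ℝ, L₁ ≤ L → ∀ δ : ℝ, 0 < δ →
      ∃ᶠ N : ℕ in Filter.atTop, (Nat.card {i : Fin N // ¬ (∃ n : EuclideanSpace ℝ (Fin 3),
        ‖n‖ = 1 ∧ ∃ c : ℤ → ℝ, (∀ k : ℤ, c k + 3 / 4 ≤ c (k + 1)) ∧ ∀ j : Fin N,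
          dist (x N j) (x N i) ≤ L → ∃ k : ℤ, |inner ℝ (x N j - x N i) n - c k| ≤ η)} : ℝ) <
        δ * N)
    (hNSF : ∀ θ R : ℝ, 0 < θ → θ < 1 → 1 ≤ R → ∃ L₀ : ℝ, ∀ L : ℝ, L₀ ≤ L → ∃ δ : ℝ, 0 < δ ∧ ∃ N₀ : ℕ,
      ∀ N : ℕ, N₀ ≤ N → ∀ x : Fin N → E3,
      (∀ j k : Fin N, j ≠ k → (7 : ℝ) / 10 ≤ dist (x j) (x k)) →
      (∀ S : Finset (Fin N), S.Nonempty → Sᶜ.Nonempty →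
          ∃ p ∈ S, ∃ k ∈ Sᶜ, dist (x p) (x k) ≤ 23 / 20) →
      δ * (N : ℝ) ≤ ((Finset.univ.filter fun i : Fin N =>
        ((Finset.univ.filter fun q : Fin N =>
            L - R < dist (x q) (x i) ∧ dist (x q) (x i) ≤ L).card : ℝ) ≤
          θ * ((Finset.univ.filter fun q : Fin N => dist (x q) (x i) ≤ L).card : ℝ)).card : ℝ))
    (hWR : ∀ η : ℝ, 0 < η → ∃ k₀ : ℕ, ∀ (N : ℕ) (x : Fin N → E3), IsGroundState lennardJones x →
      ∀ S : Finset (Fin N), k₀ ≤ S.card →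
        ∑ i ∈ S, ∑ k ∈ S, lennardJones (dist (x i) (x k)) +
            2 * ∑ i ∈ S, ∑ k ∈ Sᶜ, lennardJones (dist (x i) (x k)) ≤
          2 * (eStar + η) * S.card)
    (hSB : ∀ ε : ℝ, 0 < ε → ∃ R C : ℝ, 1 ≤ R ∧ 0 < C ∧ ∀ (N : ℕ) (x : Fin N → E3),
      (∀ j k : Fin N, j ≠ k → (7 : ℝ) / 10 ≤ dist (x j) (x k)) → ∀ (i : Fin N) (L : ℝ),
        ∑ j ∈ Finset.univ.filter (fun j : Fin N => dist (x j) (x i) ≤ L),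
            ∑ k ∈ Finset.univ.filter (fun k : Fin N => ¬ dist (x k) (x i) ≤ L),
              max (-lennardJones (dist (x j) (x k))) 0 ≤
          ε * ((Finset.univ.filter fun j : Fin N => dist (x j) (x i) ≤ L).card : ℝ) +
            C * ((Finset.univ.filter fun j : Fin N =>
              L - R < dist (x j) (x i) ∧ dist (x j) (x i) ≤ L).card : ℝ))
    (hPC : ∀ (N : ℕ) (x : Fin N → E3) (ρ : ℝ), 0 < ρ →
      (∀ S : Finset (Fin N), S.Nonempty → Sᶜ.Nonempty → ∃ p ∈ S, ∃ k ∈ Sᶜ, dist (x p) (x k) ≤ ρ) →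
      ∀ (i : Fin N) (L : ℝ), 0 ≤ L → (∃ j : Fin N, L < dist (x j) (x i)) →
        L / ρ ≤ ((Finset.univ.filter fun j : Fin N => dist (x j) (x i) ≤ L).card : ℝ)) :
    ∀ x : (N : ℕ) → (Fin N → EuclideanSpace ℝ (Fin 3)), (∀ N, IsGroundState lennardJones (x N)) →
      ∀ ε : ℝ, 0 < ε → ∃ L₀ : ℝ, ∀ L : ℝ, L₀ ≤ L → ∃ᶠ N in Filter.atTop,
        ∃ (i : Fin N) (A : EuclideanSpace ℝ (Fin 3) →ₗᵢ[ℝ] EuclideanSpace ℝ (Fin 3)) (T : Set ℝ),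
          (∀ t ∈ T, ∀ t' ∈ T, t ≠ t' → (3 : ℝ) / 4 ≤ |t - t'|) ∧
          (∀ j k : Fin N, j ≠ k → dist (x N j) (x N i) ≤ L → dist (x N k) (x N i) ≤ L →
            (7 : ℝ) / 10 ≤ dist (x N j) (x N k)) ∧
          (∀ j : Fin N, dist (x N j) (x N i) ≤ L → ∃ t ∈ T, |(A (x N j - x N i)) 2 - t| ≤ η) ∧
          (∑ j : Fin N, ∑ k : Fin N, if j ≠ k ∧ dist (x N j) (x N i) ≤ L ∧ dist (x N k) (x N i) ≤ L
              then lennardJones (dist (x N j) (x N k)) else 0) ≤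
            2 * ((⨅ Q : PeriodicConfiguration 3, Q.energyPerParticle lennardJones) + ε) *
              (Nat.card {j : Fin N // dist (x N j) (x N i) ≤ L} : ℝ) := by
  -- adapted from `stub_glueNSF` (…LjLaminarWindowsGlueNSF.lean, lead c8)
  intro x hx ε hε
  classical
  -- ground-state facts used throughout
  have hsep : ∀ (N : ℕ) (j k : Fin N), j ≠ k → (7 : ℝ) / 10 ≤ dist (x N j) (x N k) :=
    fun N j k hjk => lennardJones_groundState_dist_ge_seven_tenths (hx N) hjk
  have hconn : ∀ (N : ℕ) (S : Finset (Fin N)), S.Nonempty → Sᶜ.Nonempty →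
      ∃ p ∈ S, ∃ k ∈ Sᶜ, dist (x N p) (x N k) ≤ 23 / 20 := fun N => glueC5_connected (hx N)
  -- constants
  obtain ⟨k₀, hk₀⟩ := hWR (ε / 4) (by positivity)
  obtain ⟨R, C, hR1, hC, hSB'⟩ := hSB (ε / 4) (by positivity)
  obtain ⟨θ, hθ, hθ1, hCθ⟩ : ∃ θ : ℝ, 0 < θ ∧ θ < 1 ∧ C * θ ≤ ε / 4 := by
    refine ⟨min (ε / (4 * C)) (1 / 2), lt_min (by positivity) (by norm_num),
      lt_of_le_of_lt (min_le_right _ _) (by norm_num), ?_⟩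
    calc C * min (ε / (4 * C)) (1 / 2) ≤ C * (ε / (4 * C)) :=
          mul_le_mul_of_nonneg_left (min_le_left _ _) hC.le
      _ = ε / 4 := by field_simp
  obtain ⟨L₀', hNSF'⟩ := hNSF θ R hθ hθ1 hR1
  obtain ⟨L₁, hL₁⟩ := hLamAt x hx
  refine ⟨max (max (max L₀' 1) (23 / 20 * k₀)) L₁, fun L hL => ?_⟩
  have hLa : max (max L₀' 1) (23 / 20 * (k₀ : ℝ)) ≤ L := le_trans (le_max_left _ _) hL
  have hL1 : 1 ≤ L := le_trans (le_trans (le_max_right _ _) (le_max_left _ _)) hLa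
  have hLpos : 0 < L := by linarith
  have hLk : 23 / 20 * (k₀ : ℝ) ≤ L := le_trans (le_max_right _ _) hLa
  have hL₀' : L₀' ≤ L := le_trans (le_trans (le_max_left _ _) (le_max_left _ _)) hLa
  have hLL₁ : L₁ ≤ L := le_trans (le_max_right _ _) hL
  -- NSF at radius `L`
  obtain ⟨δ, hδ, N₀, hN₀⟩ := hNSF' L hL₀'
  -- the laminarity residual (frequently in `N`) and eventual bounds in `N`
  have hE1 := hL₁ L hLL₁ δ hδ
  have hE2 : ∀ᶠ N : ℕ in atTop, k₀ ≤ N := eventually_ge_atTop k₀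
  have hE4 : ∀ᶠ N : ℕ in atTop, N₀ ≤ N := eventually_ge_atTop N₀
  refine (hE1.and_eventually (hE2.and hE4)).mono ?_
  rintro N ⟨h1, h2, h4⟩
  have hxN := hx N
  -- the laminarity predicate at radius `L`, thickness `η`
  let lam : Fin N → Prop := fun i => ∃ n : EuclideanSpace ℝ (Fin 3), ‖n‖ = 1 ∧
    ∃ c : ℤ → ℝ, (∀ k : ℤ, c k + 3 / 4 ≤ c (k + 1)) ∧ ∀ j : Fin N,
      dist (x N j) (x N i) ≤ L → ∃ k : ℤ, |inner ℝ (x N j - x N i) n - c k| ≤ η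
  -- ball counts and shell counts
  let w : Fin N → ℝ := fun i => ((Finset.univ.filter fun j : Fin N => dist (x N j) (x N i) ≤ L).card : ℝ)
  let s : Fin N → ℝ := fun i => ((Finset.univ.filter fun j : Fin N =>
    L - R < dist (x N j) (x N i) ∧ dist (x N j) (x N i) ≤ L).card : ℝ)
  -- pigeonhole: a non-spiky laminar particle
  obtain ⟨i, hsi, hlami⟩ : ∃ i, s i ≤ θ * w i ∧ lam i := by
    by_contra hcon
    push Not at hcon
    have hsub : (Finset.univ.filter fun i : Fin N => s i ≤ θ * w i) ⊆
        Finset.univ.filter fun i => ¬ lam i := by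
      intro i hi
      simp only [Finset.mem_filter, Finset.mem_univ, true_and] at hi ⊢
      exact hcon i hi
    have hle : ((Finset.univ.filter fun i : Fin N => s i ≤ θ * w i).card : ℝ) ≤
        ((Finset.univ.filter fun i => ¬ lam i).card : ℝ) := by
      exact_mod_cast Finset.card_le_card hsub
    have hnsf : δ * (N : ℝ) ≤ ((Finset.univ.filter fun i : Fin N => s i ≤ θ * w i).card : ℝ) :=
      hN₀ N h4 (x N) (hsep N) (hconn N)
    have hlt : ((Finset.univ.filter fun i => ¬ lam i).card : ℝ) < δ * (N : ℝ) := by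
      have h1' := h1
      rw [glue_natCard_filter] at h1'
      exact h1'
    linarith
  -- the window of `i`
  set B : Finset (Fin N) := Finset.univ.filter fun j : Fin N => dist (x N j) (x N i) ≤ L with hB
  have hBcard : (B.card : ℝ) = w i := rfl
  -- (a) laminarity ⇒ isometry and height set
  obtain ⟨n, hn, c, hc, hwin⟩ := hlami
  obtain ⟨A, T, hT, hlamin⟩ := laminar_of_levels (x N) i L η n hn c hc hwin
  -- (b) the window holds at least `k₀` particles
  have hBk : k₀ ≤ B.card := by
    by_cases hfar : ∃ j : Fin N, L < dist (x N j) (x N i)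
    · have hpc := hPC N (x N) (23 / 20) (by norm_num) (hconn N) i L hLpos.le hfar
      have h' : (k₀ : ℝ) ≤ L / (23 / 20) := by
        rw [le_div_iff₀ (by norm_num : (0 : ℝ) < 23 / 20)]
        linarith
      exact_mod_cast h'.trans hpc
    · push Not at hfar
      have hBu : B = Finset.univ := by
        ext j
        simp only [hB, Finset.mem_filter, Finset.mem_univ, true_and, iff_true]
        exact hfar j
      rw [hBu, Finset.card_univ, Fintype.card_fin]
      exact h2
  -- (c) window removal and the shell bound
  have hrem := hk₀ N (x N) hxN B hBk
  have hcross := hSB' N (x N) (hsep N) i L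
  have hBc : Bᶜ = Finset.univ.filter fun k : Fin N => ¬ dist (x N k) (x N i) ≤ L := by
    rw [hB, Finset.compl_filter]
  have hneg : -(∑ j ∈ B, ∑ k ∈ Bᶜ, lennardJones (dist (x N j) (x N k))) ≤
      ∑ j ∈ B, ∑ k ∈ Finset.univ.filter (fun k : Fin N => ¬ dist (x N k) (x N i) ≤ L),
        max (-lennardJones (dist (x N j) (x N k))) 0 := by
    rw [hBc, ← Finset.sum_neg_distrib]
    refine Finset.sum_le_sum fun j _ => ?_
    rw [← Finset.sum_neg_distrib]
    exact Finset.sum_le_sum fun k _ => le_max_left _ _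
  have hw0 : 0 ≤ w i := Nat.cast_nonneg _
  have hshell : C * s i ≤ ε / 4 * w i := by
    have h1 : C * s i ≤ C * (θ * w i) := mul_le_mul_of_nonneg_left hsi hC.le
    have h2 : C * θ * w i ≤ ε / 4 * w i := mul_le_mul_of_nonneg_right hCθ hw0
    rw [← mul_assoc] at h1
    exact h1.trans h2
  have henergy : ∑ j ∈ B, ∑ k ∈ B, lennardJones (dist (x N j) (x N k)) ≤
      2 * (eStar + ε) * (B.card : ℝ) := by
    have hcross' : ∑ j ∈ B, ∑ k ∈ Finset.univ.filter (fun k : Fin N => ¬ dist (x N k) (x N i) ≤ L),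
        max (-lennardJones (dist (x N j) (x N k))) 0 ≤ ε / 4 * w i + C * s i := hcross
    rw [hBcard]
    nlinarith [hrem, hneg, hcross', hshell, hw0, hε]
  -- (d) assemble
  refine ⟨i, A, T, hT, fun j k hjk _ _ => hsep N j k hjk, hlamin, ?_⟩
  rw [← glueC5_window_sum_eq (x N) i L, glue_natCard_filter]
  exact henergy

/-- **`LjLaminarWindows` from the exact residual** (registered stub `stub_laminarityAt` of skeleton
rev. 16 of line `Sketch`): if for every thickness `η > 0`, along every sequence of Lennard-Jones ground
states, for all large radii `L` and every `δ > 0`, frequently in `N` fewer than `δ N` particles have a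
non-`(η, L)`-laminar window, then the crux holds.  (NSF, window removal, shell bound and path count are
the tree theorems `nsf_holds`, `stub_windowRemoval`, `stub_shellBound`, `stub_pathCount`.) [folklore] -/
theorem LjLaminarWindows_of_laminarityAt
    (hLamAt : ∀ η : ℝ, 0 < η → ∀ x : (N : ℕ) → (Fin N → EuclideanSpace ℝ (Fin 3)),
      (∀ N, IsGroundState lennardJones (x N)) → ∃ L₁ : ℝ, ∀ L : ℝ, L₁ ≤ L → ∀ δ : ℝ, 0 < δ →
      ∃ᶠ N : ℕ in Filter.atTop, (Nat.card {i : Fin N // ¬ (∃ n : EuclideanSpace ℝ (Fin 3),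
        ‖n‖ = 1 ∧ ∃ c : ℤ → ℝ, (∀ k : ℤ, c k + 3 / 4 ≤ c (k + 1)) ∧ ∀ j : Fin N,
          dist (x N j) (x N i) ≤ L → ∃ k : ℤ, |inner ℝ (x N j - x N i) n - c k| ≤ η)} : ℝ) <
        δ * N) :
    Summit.AtomisticToContinuum.Crystallization.Theses.ChessboardParticlePlanes.LjLaminarWindows := by
  unfold Summit.AtomisticToContinuum.Crystallization.Theses.ChessboardParticlePlanes.LjLaminarWindows
  intro x hx η ε hη hε
  exact glueNSF_at η (hLamAt η hη) nsf_holds stub_windowRemoval stub_shellBound stub_pathCount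
    x hx ε hε

/-- **Registered stub `stub_cruxOfLaminarityAt` of skeleton rev. 16 (line `Sketch`)**: the laminarity
residual (for every `η > 0`) implies the body of the crux `LjLaminarWindows` — `glueNSF_at` composed with
the tree theorems `nsf_holds`, `stub_windowRemoval`, `stub_shellBound`, `stub_pathCount`. [folklore] -/
theorem stub_cruxOfLaminarityAt :
    (∀ η : ℝ, 0 < η → ∀ x : (N : ℕ) → (Fin N → EuclideanSpace ℝ (Fin 3)),
      (∀ N, IsGroundState lennardJones (x N)) → ∃ L₁ : ℝ, ∀ L : ℝ, L₁ ≤ L → ∀ δ : ℝ, 0 < δ →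
      ∃ᶠ N : ℕ in Filter.atTop, (Nat.card {i : Fin N // ¬ (∃ n : EuclideanSpace ℝ (Fin 3),
        ‖n‖ = 1 ∧ ∃ c : ℤ → ℝ, (∀ k : ℤ, c k + 3 / 4 ≤ c (k + 1)) ∧ ∀ j : Fin N,
          dist (x N j) (x N i) ≤ L → ∃ k : ℤ, |inner ℝ (x N j - x N i) n - c k| ≤ η)} : ℝ) <
        δ * N) →
    ∀ x : (N : ℕ) → (Fin N → EuclideanSpace ℝ (Fin 3)), (∀ N, IsGroundState lennardJones (x N)) →
      ∀ η ε : ℝ, 0 < η → 0 < ε → ∃ L₀ : ℝ, ∀ L : ℝ, L₀ ≤ L → ∃ᶠ N in Filter.atTop,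
        ∃ (i : Fin N) (A : EuclideanSpace ℝ (Fin 3) →ₗᵢ[ℝ] EuclideanSpace ℝ (Fin 3)) (T : Set ℝ),
          (∀ t ∈ T, ∀ t' ∈ T, t ≠ t' → (3 : ℝ) / 4 ≤ |t - t'|) ∧
          (∀ j k : Fin N, j ≠ k → dist (x N j) (x N i) ≤ L → dist (x N k) (x N i) ≤ L →
            (7 : ℝ) / 10 ≤ dist (x N j) (x N k)) ∧
          (∀ j : Fin N, dist (x N j) (x N i) ≤ L → ∃ t ∈ T, |(A (x N j - x N i)) 2 - t| ≤ η) ∧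
          (∑ j : Fin N, ∑ k : Fin N, if j ≠ k ∧ dist (x N j) (x N i) ≤ L ∧ dist (x N k) (x N i) ≤ L
              then lennardJones (dist (x N j) (x N k)) else 0) ≤
            2 * ((⨅ Q : PeriodicConfiguration 3, Q.energyPerParticle lennardJones) + ε) *
              (Nat.card {j : Fin N // dist (x N j) (x N i) ≤ L} : ℝ) :=
  fun hLamAt x hx η ε hη hε =>
    glueNSF_at η (hLamAt η hη) nsf_holds stub_windowRemoval stub_shellBound stub_pathCount x hx ε hε

/-- **The residual from a.e. laminarity.** The statement of board item stmt-AtomisticToContinuum-14293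
(`LaminarSixThreeThree.LjLaminarity`: for every `t, R > 0` the density of particles with a
non-`(t, R)`-laminar window tends to `0`) implies the residual hypothesis of
`LjLaminarWindows_of_laminarityAt` (with `L₁ = 1`: `Tendsto → 0` gives the bound eventually, hence
frequently). [folklore] -/
theorem laminarityAt_of_laminarity
    (hLam : ∀ t R : ℝ, 0 < t → 0 < R → ∀ x : (N : ℕ) → (Fin N → EuclideanSpace ℝ (Fin 3)),
      (∀ N, IsGroundState lennardJones (x N)) →
      Filter.Tendsto (fun N : ℕ => (Nat.card {i : Fin N // ¬ (∃ n : EuclideanSpace ℝ (Fin 3),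
        ‖n‖ = 1 ∧ ∃ c : ℤ → ℝ, (∀ k : ℤ, c k + 3 / 4 ≤ c (k + 1)) ∧ ∀ j : Fin N,
          dist (x N j) (x N i) ≤ R → ∃ k : ℤ, |inner ℝ (x N j - x N i) n - c k| ≤ t)} : ℝ) / N)
        Filter.atTop (nhds 0)) :
    ∀ η : ℝ, 0 < η → ∀ x : (N : ℕ) → (Fin N → EuclideanSpace ℝ (Fin 3)),
      (∀ N, IsGroundState lennardJones (x N)) → ∃ L₁ : ℝ, ∀ L : ℝ, L₁ ≤ L → ∀ δ : ℝ, 0 < δ →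
      ∃ᶠ N : ℕ in Filter.atTop, (Nat.card {i : Fin N // ¬ (∃ n : EuclideanSpace ℝ (Fin 3),
        ‖n‖ = 1 ∧ ∃ c : ℤ → ℝ, (∀ k : ℤ, c k + 3 / 4 ≤ c (k + 1)) ∧ ∀ j : Fin N,
          dist (x N j) (x N i) ≤ L → ∃ k : ℤ, |inner ℝ (x N j - x N i) n - c k| ≤ η)} : ℝ) <
        δ * N := by
  intro η hη x hx
  refine ⟨1, fun L hL δ hδ => ?_⟩
  have hLpos : 0 < L := by linarith
  have hE1 := (hLam η L hη hLpos x hx).eventually (gt_mem_nhds hδ)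
  have hE3 : ∀ᶠ N : ℕ in atTop, 1 ≤ N := eventually_ge_atTop 1
  refine (hE1.and hE3).frequently.mono ?_
  rintro N ⟨h1, h3⟩
  have hNpos : (0 : ℝ) < N := by exact_mod_cast h3
  rwa [div_lt_iff₀ hNpos] at h1

/-- **Thick layers are free.** For `t ≥ 3/8` every window of every configuration is `t`-laminar: with
any unit normal and the levels `c k = (3/4) k` (consecutive gaps exactly `3/4`), every height is within
`3/8` of a level (`|u - round u| ≤ 1/2` at `u = 4h/3`). [folklore] -/
theorem laminar_of_three_eighths_le {N : ℕ} (x : Fin N → EuclideanSpace ℝ (Fin 3)) (i : Fin N)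
    (R t : ℝ) (ht : 3 / 8 ≤ t) :
    ∃ n : EuclideanSpace ℝ (Fin 3), ‖n‖ = 1 ∧ ∃ c : ℤ → ℝ, (∀ k : ℤ, c k + 3 / 4 ≤ c (k + 1)) ∧
      ∀ j : Fin N, dist (x j) (x i) ≤ R → ∃ k : ℤ, |inner ℝ (x j - x i) n - c k| ≤ t := by
  refine ⟨EuclideanSpace.single (0 : Fin 3) (1 : ℝ), by simp, fun k => 3 / 4 * (k : ℝ),
    fun k => ?_, fun j _ => ?_⟩
  · push_cast
    linarith
  · set h : ℝ := inner ℝ (x j - x i) (EuclideanSpace.single (0 : Fin 3) (1 : ℝ)) with hh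
    refine ⟨round (4 * h / 3), ?_⟩
    have hr : |4 * h / 3 - round (4 * h / 3)| ≤ 1 / 2 := abs_sub_round _
    have e : h - 3 / 4 * (round (4 * h / 3) : ℝ) = 3 / 4 * (4 * h / 3 - round (4 * h / 3)) := by
      ring
    rw [e, abs_mul, abs_of_pos (by norm_num : (0 : ℝ) < 3 / 4)]
    linarith

/-- Hence the residual hypothesis of `LjLaminarWindows_of_laminarityAt` holds UNCONDITIONALLY at every
thickness `η ≥ 3/8`: the set of particles with a non-laminar window is empty. [folklore] -/
theorem laminarityAt_of_three_eighths_le (η : ℝ) (hη : 3 / 8 ≤ η) :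
    ∀ x : (N : ℕ) → (Fin N → EuclideanSpace ℝ (Fin 3)),
      (∀ N, IsGroundState lennardJones (x N)) → ∃ L₁ : ℝ, ∀ L : ℝ, L₁ ≤ L → ∀ δ : ℝ, 0 < δ →
      ∃ᶠ N : ℕ in Filter.atTop, (Nat.card {i : Fin N // ¬ (∃ n : EuclideanSpace ℝ (Fin 3),
        ‖n‖ = 1 ∧ ∃ c : ℤ → ℝ, (∀ k : ℤ, c k + 3 / 4 ≤ c (k + 1)) ∧ ∀ j : Fin N,
          dist (x N j) (x N i) ≤ L → ∃ k : ℤ, |inner ℝ (x N j - x N i) n - c k| ≤ η)} : ℝ) <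
        δ * N := by
  intro x _
  refine ⟨0, fun L _ δ hδ => ?_⟩
  have hE3 : ∀ᶠ N : ℕ in atTop, 1 ≤ N := eventually_ge_atTop 1
  refine hE3.frequently.mono fun N hN => ?_
  have hempty : IsEmpty {i : Fin N // ¬ (∃ n : EuclideanSpace ℝ (Fin 3),
      ‖n‖ = 1 ∧ ∃ c : ℤ → ℝ, (∀ k : ℤ, c k + 3 / 4 ≤ c (k + 1)) ∧ ∀ j : Fin N,
        dist (x N j) (x N i) ≤ L → ∃ k : ℤ, |inner ℝ (x N j - x N i) n - c k| ≤ η)} :=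
    ⟨fun ⟨i, hi⟩ => hi (laminar_of_three_eighths_le (x N) i L η hη)⟩
  rw [Nat.card_of_isEmpty, Nat.cast_zero]
  have hNpos : (0 : ℝ) < N := by exact_mod_cast hN
  positivity

/-- **The crux minus layering is a theorem (unconditional).** For every sequence of Lennard-Jones ground
states in `ℝ³`, every thickness `η ≥ 3/8` and every `ε > 0` there is `L₀` such that for every `L ≥ L₀`,
frequently in `N`, some particle `i`, linear isometry `A` and `3/4`-separated height set `T` satisfy
all four clauses of `LjLaminarWindows`: the closed `L`-ball around `xᵢ` is `7/10`-separated, `η`-laminar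
(vacuously, `T = (3/4)ℤ`), and its internal energy is `≤ 2(⨅_Q e(Q) + ε)` per particle.  Inputs, all
landed: `7/10` minimal distance, `23/20` connectivity, window removal, shell bound, path count, NSF.
The open content of stmt-AtomisticToContinuum-6711 is exactly the case `η < 3/8`. [folklore] -/
theorem ljLaminarWindows_of_three_eighths_le :
    ∀ x : (N : ℕ) → (Fin N → EuclideanSpace ℝ (Fin 3)),
      (∀ N, IsGroundState lennardJones (x N)) →
      ∀ η ε : ℝ, 3 / 8 ≤ η → 0 < ε → ∃ L₀ : ℝ, ∀ L : ℝ, L₀ ≤ L → ∃ᶠ N in Filter.atTop,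
        ∃ (i : Fin N) (A : EuclideanSpace ℝ (Fin 3) →ₗᵢ[ℝ] EuclideanSpace ℝ (Fin 3)) (T : Set ℝ),
          (∀ t ∈ T, ∀ t' ∈ T, t ≠ t' → (3 : ℝ) / 4 ≤ |t - t'|) ∧
          (∀ j k : Fin N, j ≠ k → dist (x N j) (x N i) ≤ L → dist (x N k) (x N i) ≤ L →
            (7 : ℝ) / 10 ≤ dist (x N j) (x N k)) ∧
          (∀ j : Fin N, dist (x N j) (x N i) ≤ L → ∃ t ∈ T, |(A (x N j - x N i)) 2 - t| ≤ η) ∧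
          (∑ j : Fin N, ∑ k : Fin N, if j ≠ k ∧ dist (x N j) (x N i) ≤ L ∧ dist (x N k) (x N i) ≤ L
              then lennardJones (dist (x N j) (x N k)) else 0) ≤
            2 * ((⨅ Q : PeriodicConfiguration 3, Q.energyPerParticle lennardJones) + ε) *
              (Nat.card {j : Fin N // dist (x N j) (x N i) ≤ L} : ℝ) :=
  fun x hx η ε hη hε =>
    glueNSF_at η (laminarityAt_of_three_eighths_le η hη) nsf_holds stub_windowRemoval
      stub_shellBound stub_pathCount x hx ε hε

end Summit.AtomisticToContinuum.Crystallization.Theorems.LjLaminarWindowsSketch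

end
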